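import Literature.MathematicalPhysics.QuantumFieldTheory.Balaban1983to89.B9Eq373BondPrincipalTwoBackgroundLetter

/-!
# `Balaban1983to89.B9Eq375BondGradDivTwoBackgroundSplit` — T. Bałaban, *Propagators for lattice gauge theories in a background field*, Commun. Math. Phys. **99** (1985) 389–434
# [Balaban1985BackgroundPropagators] (3.74)–(3.75) p. 405 (*«(D_{U′U}D*_{U′U}A′)_μ(x) = (DD*A′)_μ(x) − … = (DD*A′)_μ(x) − (V₂(A)A′)_μ(x), where the operators F₂,… V₂(A) satisfy the bounds
# (3.72), (3.73)»*), with (3.3) p. 391, (3.8) p. 392, (3.35) p. 396: **THE FIRST-ORDER (LEIBNIZ) SPLIT OF THE GRADIENT-OF-DIVERGENCE OPERATOR `DD*` ON BOND FUNCTIONS BETWEEN TWO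
# BACKGROUNDS, POINTWISE AND AS A LOCAL LETTER** — abstract transporters `R(b)`, `S(b)` with `‖R(b)w − w‖, ‖S(b)w − w‖ ≤ ε‖w‖` and the variation `‖S(x+e_ν,μ)w − S(x,μ)w‖ ≤ ε′‖w‖`:
# `‖((D_RD*_S − D_1D*_1)A)(x,ν)‖ ≤ d·((‖c‖²ε² + ‖c‖²ε′)M₀ + 2‖c‖εM₁)` with `M₀` a bound of `A` and `M₁` of the FLAT gradient `∇_1A` near `x`; and, for a bond function with VALUE and
# FLAT-GRADIENT letters decaying from a block `v`, the same as a LETTER with the small factor — the `DD*` companion of `B9Eq371BondPrincipalTwoBackgroundSplit` ∕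
# `B9Eq373BondPrincipalTwoBackgroundLetter` (brick G-4a of the bond storey: by (3.25) `Δ_a = Δ + DRD* + Q*aQ` and `R = 1 − G′Q̃′*cQ̃′G′`, the member `DRD*` splits into THIS local piece `DD*` and the
# smooth word `D(G′Q̃′*cQ̃′G′)D*`)

statement-level skeleton of published theorems with citation tags; proofs where landed; nothing here is a claim about the Yang–Mills mass gap

CITATION HEADER (lean-in-tree rule).  Audit cell `pub-balaban`, sub-cell `t4`, BINDER row NE9; NE9 crux-team LEAF PROVER 01 (`b2b-balaban-t4-ne9-formalise-leaf-01`, gen 100;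
bears_on: R4/N22).  Vocabulary BY NAME: the OWNER's `B9Eq33CovDerivVector.{covDeriv, covDiv, covGrad}` ((3.3), (3.8)), `B9SectCLatticeCarrier.{shift, unshift}`; this gen's
`B9Eq371BondPrincipalTwoBackgroundSplit.shift_unshift_comm`, `B9Eq373BondPrincipalTwoBackgroundLetter.{exp_step_le, exp_two_steps_le}`.  Sources: [Balaban1985BackgroundPropagators] pp. 391–392,
396, 405 (text layer pp. 3–4, 8, 17 read by this lineage 2026-08-28).  Print obtains (3.75) from the analytic expansion `R(U′) = exp(ηi ad A)`; the cell's real two-background version is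
[folklore] finite-difference algebra; NOTHING of print's proof is reproduced.

WHAT IS PROVED (sorry-free; proof lane — no `def`).
* §1 `covDeriv_sub_flat_apply`, `covDiv_sub_flat_apply` (zeroth-order differences), `covDiv_flat_eq_neg_sum_covGrad` (`D*_1A = −Σ_μ(∇_1A)((·−e_μ,μ),μ)`),
  `q_shift_sub_q_eq` ∕ `norm_q_shift_sub_q_le` (the Leibniz step for `q = (D*_S − D*_1)A`).
* §2 **`gradDiv_sub_flat_eq`** (`D_RD*_S − D_1D*_1 = D_R(D*_S − D*_1) + (D_R − D_1)D*_1`) and **`norm_gradDiv_sub_flat_apply_le`** (pointwise bound).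
* §3 **`norm_gradDiv_sub_flat_apply_le_of_letters`** (letter form, decay bookkeeping as in `B9Eq373BondPrincipalTwoBackgroundLetter`).
HONEST SCOPE.  Pointwise finite-difference bookkeeping; no propagator named; the smooth word `D(G′Q̃′*cQ̃′G′)D*`, the `Q*aQ` member and the resolvent step are NOT here.  NE9 NOT PRINTED ∕ NOT PROVED;
spine PROVED 0∕9; rung (B)+1 finite T⁴ — NOT infinite volume, NOT mass gap, NOT BetaPertH, NOT Clay.  HONEST DEPENDENCY: continuum YM on T⁴ ⇐ BetaPertH ∧ nine spine estimates (0/9 proved);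
BetaPertH ⇐ (D1) ∧ (D4) ∧ CAP+tail; G-an2-4 gates asym, D1 and NE2/3/4.  NEW file; nothing modified.  Net new unproved facts: 0.
-/

noncomputable section

open scoped BigOperators

namespace Literature.MathematicalPhysics.QuantumFieldTheory.Balaban1983to89.B9Eq375BondGradDivTwoBackgroundSplit

open B4Sect5Torus (TSite)
open B9SectCLatticeCarrier (Bond bpos btgt shift unshift shift_unshift unshift_shift)
open B9Eq33CovDerivVector (covDeriv covDiv covGrad covDeriv_apply covDiv_apply covGrad_apply_dir)
open B9Eq371BondPrincipalTwoBackgroundSplit (shift_unshift_comm)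
open B9Eq373BondPrincipalTwoBackgroundLetter (exp_step_le exp_two_steps_le)

variable {d : ℕ} {P : Fin d → ℕ} {W : Type*} [NormedAddCommGroup W] [NormedSpace ℂ W]

section Split

variable (c : ℂ) (R S : Bond d P → W →ₗ[ℂ] W)

/-! ## §1 Zeroth-order differences and the Leibniz step -/

/-- **`(D_Rh − D_1h)(b) = c•(R(b) − 1)h(b₊)`** ((3.3) with `R` against (3.3) with `1`). [folklore] [cite: Balaban1985BackgroundPropagators, (3.3) p.391, (3.74) p.405] -/
theorem covDeriv_sub_flat_apply (h : TSite d P → W) (b : Bond d P) :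
    covDeriv c R h b - covDeriv c (fun _ : Bond d P => (LinearMap.id : W →ₗ[ℂ] W)) h b = c • (R b (h (btgt b)) - h (btgt b)) := by
  rw [covDeriv_apply, covDeriv_apply]
  simp only [LinearMap.id_coe, id_eq, smul_sub]
  abel

/-- **`(D*_SA − D*_1A)(y) = c•Σ_μ(S(y−e_μ,μ) − 1)A(y−e_μ,μ)`** ((3.8) with `S` against (3.8) with `1`). [folklore] [cite: Balaban1985BackgroundPropagators, (3.8) p.392, (3.75) p.405] -/
theorem covDiv_sub_flat_apply (A : Bond d P → W) (y : TSite d P) :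
    covDiv c S A y - covDiv c (fun _ : Bond d P => (LinearMap.id : W →ₗ[ℂ] W)) A y = c • ∑ μ, (S (unshift μ y, μ) (A (unshift μ y, μ)) - A (unshift μ y, μ)) := by
  rw [covDiv_apply, covDiv_apply, ← smul_sub, ← Finset.sum_sub_distrib]
  congr 1
  refine Finset.sum_congr rfl fun μ _ => ?_
  simp only [LinearMap.id_coe, id_eq]
  abel

/-- **The flat divergence through the flat gradient**: `(D*_1A)(y) = −Σ_μ(∇_1A)((y−e_μ,μ),μ)`. [folklore] [cite: Balaban1985BackgroundPropagators, (3.8) p.392, (3.3) p.391] -/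
theorem covDiv_flat_eq_neg_sum_covGrad (A : Bond d P → W) (y : TSite d P) :
    covDiv c (fun _ : Bond d P => (LinearMap.id : W →ₗ[ℂ] W)) A y = -∑ μ, covGrad c (fun _ : Bond d P => (LinearMap.id : W →ₗ[ℂ] W)) A ((unshift μ y, μ), μ) := by
  rw [covDiv_apply, Finset.smul_sum, ← Finset.sum_neg_distrib]
  refine Finset.sum_congr rfl fun μ _ => ?_
  rw [covGrad_apply_dir, shift_unshift]
  simp only [LinearMap.id_coe, id_eq, smul_sub, neg_sub]

/-- **THE LEIBNIZ STEP for `q = (D*_S − D*_1)A`** between `y+e_ν` and `y` (`c ≠ 0`): transporter VARIATION times value plus (transporter − 1) times the FLAT gradient in direction `ν`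
(`A((y−e_μ)+e_ν, μ) − A(y−e_μ, μ) = c⁻¹•(∇_1A)((y−e_μ,ν),μ)`, with `(y+e_ν)−e_μ = (y−e_μ)+e_ν`). [folklore] [cite: Balaban1985BackgroundPropagators, (3.75) p.405, (3.3) p.391, (3.8) p.392] -/
theorem q_shift_sub_q_eq (hc : c ≠ 0) (A : Bond d P → W) (y : TSite d P) (ν : Fin d) :
    (covDiv c S A (shift ν y) - covDiv c (fun _ : Bond d P => (LinearMap.id : W →ₗ[ℂ] W)) A (shift ν y)) -
        (covDiv c S A y - covDiv c (fun _ : Bond d P => (LinearMap.id : W →ₗ[ℂ] W)) A y) =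
      c • ∑ μ, ((S (shift ν (unshift μ y), μ) (A (shift ν (unshift μ y), μ)) - S (unshift μ y, μ) (A (shift ν (unshift μ y), μ))) +
        c⁻¹ • (S (unshift μ y, μ) (covGrad c (fun _ : Bond d P => (LinearMap.id : W →ₗ[ℂ] W)) A ((unshift μ y, ν), μ)) -
          covGrad c (fun _ : Bond d P => (LinearMap.id : W →ₗ[ℂ] W)) A ((unshift μ y, ν), μ))) := by
  rw [covDiv_sub_flat_apply, covDiv_sub_flat_apply, ← smul_sub, ← Finset.sum_sub_distrib]
  congr 1
  refine Finset.sum_congr rfl fun μ _ => ?_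
  rw [← shift_unshift_comm]
  simp only [covGrad_apply_dir, LinearMap.id_coe, id_eq, map_smul, map_sub, smul_sub, smul_smul, inv_mul_cancel₀ hc, one_smul]
  abel

/-- **SIZE OF THE LEIBNIZ STEP**: `‖c•(q(y+e_ν) − q(y))‖ ≤ Σ_μ (‖c‖²·ε′·‖A((y−e_μ)+e_ν,μ)‖ + ‖c‖·ε·‖(∇_1A)((y−e_μ,ν),μ)‖)` from `‖S(x+e_ν,μ)w − S(x,μ)w‖ ≤ ε′‖w‖` and `‖S(b)w − w‖ ≤ ε‖w‖`.
[folklore] [cite: Balaban1985BackgroundPropagators, (3.73) p.405, (3.75) p.405, (3.35) p.396] -/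
theorem norm_q_shift_sub_q_le (hc : c ≠ 0) {ε ε' : ℝ} (hSε : ∀ b w, ‖S b w - w‖ ≤ ε * ‖w‖)
    (hSε' : ∀ (x : TSite d P) (ν μ : Fin d) (w : W), ‖S (shift ν x, μ) w - S (x, μ) w‖ ≤ ε' * ‖w‖) (A : Bond d P → W) (y : TSite d P) (ν : Fin d) :
    ‖c • ((covDiv c S A (shift ν y) - covDiv c (fun _ : Bond d P => (LinearMap.id : W →ₗ[ℂ] W)) A (shift ν y)) -
        (covDiv c S A y - covDiv c (fun _ : Bond d P => (LinearMap.id : W →ₗ[ℂ] W)) A y))‖ ≤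
      ∑ μ, (‖c‖ ^ 2 * (ε' * ‖A (shift ν (unshift μ y), μ)‖) + ‖c‖ * (ε * ‖covGrad c (fun _ : Bond d P => (LinearMap.id : W →ₗ[ℂ] W)) A ((unshift μ y, ν), μ)‖)) := by
  rw [q_shift_sub_q_eq c S hc, smul_smul, norm_smul, norm_mul]
  refine (mul_le_mul_of_nonneg_left (norm_sum_le _ _) (by positivity)).trans ?_
  rw [Finset.mul_sum]
  refine Finset.sum_le_sum fun μ _ => ?_
  have hc0 : 0 ≤ ‖c‖ := norm_nonneg c
  have h1 : ‖S (shift ν (unshift μ y), μ) (A (shift ν (unshift μ y), μ)) - S (unshift μ y, μ) (A (shift ν (unshift μ y), μ))‖ ≤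
      ε' * ‖A (shift ν (unshift μ y), μ)‖ := hSε' _ _ _ _
  have h2 : ‖c⁻¹ • (S (unshift μ y, μ) (covGrad c (fun _ : Bond d P => (LinearMap.id : W →ₗ[ℂ] W)) A ((unshift μ y, ν), μ)) -
      covGrad c (fun _ : Bond d P => (LinearMap.id : W →ₗ[ℂ] W)) A ((unshift μ y, ν), μ))‖ ≤
      ‖c‖⁻¹ * (ε * ‖covGrad c (fun _ : Bond d P => (LinearMap.id : W →ₗ[ℂ] W)) A ((unshift μ y, ν), μ)‖) := by
    rw [norm_smul, norm_inv]
    exact mul_le_mul_of_nonneg_left (hSε _ _) (inv_nonneg.mpr hc0)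
  have hcne : ‖c‖ ≠ 0 := norm_ne_zero_iff.mpr hc
  calc ‖c‖ * ‖c‖ * ‖(S (shift ν (unshift μ y), μ) (A (shift ν (unshift μ y), μ)) - S (unshift μ y, μ) (A (shift ν (unshift μ y), μ))) +
          c⁻¹ • (S (unshift μ y, μ) (covGrad c (fun _ : Bond d P => (LinearMap.id : W →ₗ[ℂ] W)) A ((unshift μ y, ν), μ)) -
            covGrad c (fun _ : Bond d P => (LinearMap.id : W →ₗ[ℂ] W)) A ((unshift μ y, ν), μ))‖
      ≤ ‖c‖ * ‖c‖ * (ε' * ‖A (shift ν (unshift μ y), μ)‖ + ‖c‖⁻¹ * (ε * ‖covGrad c (fun _ : Bond d P => (LinearMap.id : W →ₗ[ℂ] W)) A ((unshift μ y, ν), μ)‖)) :=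
        mul_le_mul_of_nonneg_left ((norm_add_le _ _).trans (add_le_add h1 h2)) (by positivity)
    _ = ‖c‖ ^ 2 * (ε' * ‖A (shift ν (unshift μ y), μ)‖) + ‖c‖ * (ε * ‖covGrad c (fun _ : Bond d P => (LinearMap.id : W →ₗ[ℂ] W)) A ((unshift μ y, ν), μ)‖) := by
        field_simp

/-! ## §2 The split and the pointwise bound -/

/-- **`D_RD*_S − D_1D*_1 = D_R(D*_S − D*_1) + (D_R − D_1)D*_1`** (pointwise). [folklore] [cite: Balaban1985BackgroundPropagators, (3.75) p.405] -/
theorem gradDiv_sub_flat_eq (A : Bond d P → W) (b : Bond d P) :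
    covDeriv c R (covDiv c S A) b - covDeriv c (fun _ : Bond d P => (LinearMap.id : W →ₗ[ℂ] W)) (covDiv c (fun _ : Bond d P => (LinearMap.id : W →ₗ[ℂ] W)) A) b =
      covDeriv c R (covDiv c S A - covDiv c (fun _ : Bond d P => (LinearMap.id : W →ₗ[ℂ] W)) A) b +
        (covDeriv c R (covDiv c (fun _ : Bond d P => (LinearMap.id : W →ₗ[ℂ] W)) A) b -
          covDeriv c (fun _ : Bond d P => (LinearMap.id : W →ₗ[ℂ] W)) (covDiv c (fun _ : Bond d P => (LinearMap.id : W →ₗ[ℂ] W)) A) b) := by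
  rw [map_sub, Pi.sub_apply]
  abel

/-- **THE FIRST-ORDER BOUND FOR `DD*` BETWEEN TWO BACKGROUNDS, POINTWISE** — `c ≠ 0`, `‖R(b)w − w‖, ‖S(b)w − w‖ ≤ ε‖w‖` (`ε ≥ 0`), `‖S(x+e_ν,μ)w − S(x,μ)w‖ ≤ ε′‖w‖`, a bond
function `A` with `‖A((x−e_μ)+e_ν, μ)‖ ≤ M₀` and FLAT gradients `‖(∇_1A)(((x−e_μ)+e_ν,μ),μ)‖ ≤ M₁`, `‖(∇_1A)((x−e_μ,ν),μ)‖ ≤ M₁` (all `μ`; `x = b₋`, `ν = b`'s direction):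
`‖((D_RD*_SA) − (D_1D*_1A))(x,ν)‖ ≤ d·((‖c‖²ε² + ‖c‖²ε′)·M₀ + 2‖c‖ε·M₁)`. [cite: Balaban1985BackgroundPropagators, (3.73)–(3.75) p.405, (3.35) p.396] -/
theorem norm_gradDiv_sub_flat_apply_le (hc : c ≠ 0) {ε ε' M₀ M₁ : ℝ} (hε : 0 ≤ ε) (hε' : 0 ≤ ε')
    (hRε : ∀ b w, ‖R b w - w‖ ≤ ε * ‖w‖) (hSε : ∀ b w, ‖S b w - w‖ ≤ ε * ‖w‖)
    (hSε' : ∀ (x : TSite d P) (ν μ : Fin d) (w : W), ‖S (shift ν x, μ) w - S (x, μ) w‖ ≤ ε' * ‖w‖)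
    (A : Bond d P → W) (x : TSite d P) (ν : Fin d)
    (hA : ∀ μ : Fin d, ‖A (shift ν (unshift μ x), μ)‖ ≤ M₀)
    (hD1 : ∀ μ : Fin d, ‖covGrad c (fun _ : Bond d P => (LinearMap.id : W →ₗ[ℂ] W)) A ((shift ν (unshift μ x), μ), μ)‖ ≤ M₁)
    (hD2 : ∀ μ : Fin d, ‖covGrad c (fun _ : Bond d P => (LinearMap.id : W →ₗ[ℂ] W)) A ((unshift μ x, ν), μ)‖ ≤ M₁) :
    ‖covDeriv c R (covDiv c S A) (x, ν) -
        covDeriv c (fun _ : Bond d P => (LinearMap.id : W →ₗ[ℂ] W)) (covDiv c (fun _ : Bond d P => (LinearMap.id : W →ₗ[ℂ] W)) A) (x, ν)‖ ≤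
      (d : ℝ) * ((‖c‖ ^ 2 * ε ^ 2 + ‖c‖ ^ 2 * ε') * M₀ + 2 * (‖c‖ * ε) * M₁) := by
  have hc0 : 0 ≤ ‖c‖ := norm_nonneg c
  set q : TSite d P → W := covDiv c S A - covDiv c (fun _ : Bond d P => (LinearMap.id : W →ₗ[ℂ] W)) A with hq
  have hq_apply : ∀ y, q y = covDiv c S A y - covDiv c (fun _ : Bond d P => (LinearMap.id : W →ₗ[ℂ] W)) A y := fun y => rfl
  have hbt : btgt (x, ν) = shift ν x := rfl
  have hbp : bpos (x, ν) = x := rfl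
  -- the value of `q` at `x + e_ν`
  have hqv : ‖q (shift ν x)‖ ≤ ‖c‖ * (ε * ∑ _μ : Fin d, M₀) := by
    rw [hq_apply, covDiv_sub_flat_apply, norm_smul, Finset.mul_sum]
    refine mul_le_mul_of_nonneg_left ((norm_sum_le _ _).trans (Finset.sum_le_sum fun μ _ => ?_)) hc0
    rw [← shift_unshift_comm]
    exact (hSε _ _).trans (mul_le_mul_of_nonneg_left (hA μ) hε)
  -- term (ii): `D_R q = c(R − 1)q(b₊) + c(q(b₊) − q(b₋))`
  have hii : ‖covDeriv c R q (x, ν)‖ ≤ ‖c‖ * (ε * (‖c‖ * (ε * ∑ _μ : Fin d, M₀))) + ∑ _μ : Fin d, (‖c‖ ^ 2 * (ε' * M₀) + ‖c‖ * (ε * M₁)) := by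
    have e : covDeriv c R q (x, ν) = c • (R (x, ν) (q (shift ν x)) - q (shift ν x)) + c • (q (shift ν x) - q x) := by
      rw [covDeriv_apply, hbt, hbp, ← smul_add]; congr 1; abel
    rw [e]
    refine (norm_add_le _ _).trans (add_le_add ?_ ?_)
    · rw [norm_smul]
      exact mul_le_mul_of_nonneg_left ((hRε _ _).trans (mul_le_mul_of_nonneg_left hqv hε)) hc0
    · rw [hq_apply, hq_apply]
      refine (norm_q_shift_sub_q_le c S hc hSε hSε' A x ν).trans (Finset.sum_le_sum fun μ _ => add_le_add ?_ ?_)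
      · exact mul_le_mul_of_nonneg_left (mul_le_mul_of_nonneg_left (hA μ) hε') (by positivity)
      · exact mul_le_mul_of_nonneg_left (mul_le_mul_of_nonneg_left (hD2 μ) hε) hc0
  -- term (i): `(D_R − D_1)(D*_1A) = c(R − 1)(D*_1A)(b₊)` with `D*_1A = −Σ_μ ∇_1A`
  have hi : ‖covDeriv c R (covDiv c (fun _ : Bond d P => (LinearMap.id : W →ₗ[ℂ] W)) A) (x, ν) -
      covDeriv c (fun _ : Bond d P => (LinearMap.id : W →ₗ[ℂ] W)) (covDiv c (fun _ : Bond d P => (LinearMap.id : W →ₗ[ℂ] W)) A) (x, ν)‖ ≤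
      ‖c‖ * (ε * ∑ _μ : Fin d, M₁) := by
    rw [covDeriv_sub_flat_apply, norm_smul, hbt]
    refine mul_le_mul_of_nonneg_left ((hRε _ _).trans (mul_le_mul_of_nonneg_left ?_ hε)) hc0
    rw [covDiv_flat_eq_neg_sum_covGrad, norm_neg]
    refine (norm_sum_le _ _).trans (Finset.sum_le_sum fun μ _ => ?_)
    rw [← shift_unshift_comm]
    exact hD1 μ
  rw [gradDiv_sub_flat_eq, ← hq]
  refine (norm_add_le _ _).trans ((add_le_add hii hi).trans (le_of_eq ?_))
  simp only [Finset.sum_const, Finset.card_univ, Fintype.card_fin, nsmul_eq_mul]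
  ring

/-! ## §3 The letter -/

/-- **THE `DD*` PIECE OF (3.85) AS A LOCAL LETTER** — abstract transporters as above, a block map `π : sites → Y` with a distance-to-`v` function `dv` that drops by at most `ρ ≥ 0` per unit
step, and a bond function `A` with the VALUE letter `‖A(x,μ)‖ ≤ B·e^{−κ·dv(πx)}·F` and the FLAT-GRADIENT letter `‖(∇_1A)((x,μ),ν)‖ ≤ B′·e^{−κ·dv(πx)}·F` (`κ, B, B′, F ≥ 0`):
`‖((D_RD*_SA) − (D_1D*_1A))(x,ν)‖ ≤ d·((‖c‖²ε² + ‖c‖²ε′)·B + 2‖c‖ε·B′)·e^{2κρ}·e^{−κ·dv(πx)}·F`.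
[cite: Balaban1985BackgroundPropagators, (3.75) p.405, (3.84)–(3.85) p.407] -/
theorem norm_gradDiv_sub_flat_apply_le_of_letters (hc : c ≠ 0) {ε ε' : ℝ} (hε : 0 ≤ ε) (hε' : 0 ≤ ε')
    (hRε : ∀ b w, ‖R b w - w‖ ≤ ε * ‖w‖) (hSε : ∀ b w, ‖S b w - w‖ ≤ ε * ‖w‖)
    (hSε' : ∀ (x : TSite d P) (ν μ : Fin d) (w : W), ‖S (shift ν x, μ) w - S (x, μ) w‖ ≤ ε' * ‖w‖)
    {Y : Type*} (π : TSite d P → Y) (dv : Y → ℝ) {ρ κ B B' F : ℝ} (hρ : 0 ≤ ρ) (hκ : 0 ≤ κ) (hB : 0 ≤ B) (hB' : 0 ≤ B') (hF : 0 ≤ F)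
    (hπs : ∀ (μ : Fin d) (x : TSite d P), dv (π x) ≤ dv (π (shift μ x)) + ρ)
    (hπu : ∀ (μ : Fin d) (x : TSite d P), dv (π x) ≤ dv (π (unshift μ x)) + ρ)
    (A : Bond d P → W)
    (hval : ∀ (x : TSite d P) (μ : Fin d), ‖A (x, μ)‖ ≤ B * Real.exp (-(κ * dv (π x))) * F)
    (hgrad : ∀ (x : TSite d P) (μ ν : Fin d),
      ‖covGrad c (fun _ : Bond d P => (LinearMap.id : W →ₗ[ℂ] W)) A ((x, μ), ν)‖ ≤ B' * Real.exp (-(κ * dv (π x))) * F)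
    (x : TSite d P) (ν : Fin d) :
    ‖covDeriv c R (covDiv c S A) (x, ν) -
        covDeriv c (fun _ : Bond d P => (LinearMap.id : W →ₗ[ℂ] W)) (covDiv c (fun _ : Bond d P => (LinearMap.id : W →ₗ[ℂ] W)) A) (x, ν)‖ ≤
      (d : ℝ) * ((‖c‖ ^ 2 * ε ^ 2 + ‖c‖ ^ 2 * ε') * B + 2 * (‖c‖ * ε) * B') * Real.exp (2 * κ * ρ) * Real.exp (-(κ * dv (π x))) * F := by
  set E := Real.exp (2 * κ * ρ) * Real.exp (-(κ * dv (π x))) with hE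
  have h1step : ∀ (μ : Fin d), Real.exp (-(κ * dv (π (unshift μ x)))) ≤ E := fun μ => by
    have h := exp_step_le (κ := κ) hκ (hπu μ x)
    refine h.trans (mul_le_mul_of_nonneg_right (Real.exp_le_exp.mpr ?_) (Real.exp_nonneg _))
    nlinarith [mul_nonneg hκ hρ]
  have h2step : ∀ (μ : Fin d), Real.exp (-(κ * dv (π (shift ν (unshift μ x))))) ≤ E := fun μ =>
    exp_two_steps_le hκ (hπu μ x) (hπs ν (unshift μ x))
  have hA : ∀ μ : Fin d, ‖A (shift ν (unshift μ x), μ)‖ ≤ B * E * F := fun μ =>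
    (hval _ _).trans (mul_le_mul_of_nonneg_right (mul_le_mul_of_nonneg_left (h2step μ) hB) hF)
  have hD1 : ∀ μ : Fin d, ‖covGrad c (fun _ : Bond d P => (LinearMap.id : W →ₗ[ℂ] W)) A ((shift ν (unshift μ x), μ), μ)‖ ≤ B' * E * F := fun μ =>
    (hgrad _ _ _).trans (mul_le_mul_of_nonneg_right (mul_le_mul_of_nonneg_left (h2step μ) hB') hF)
  have hD2 : ∀ μ : Fin d, ‖covGrad c (fun _ : Bond d P => (LinearMap.id : W →ₗ[ℂ] W)) A ((unshift μ x, ν), μ)‖ ≤ B' * E * F := fun μ =>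
    (hgrad _ _ _).trans (mul_le_mul_of_nonneg_right (mul_le_mul_of_nonneg_left (h1step μ) hB') hF)
  have h := norm_gradDiv_sub_flat_apply_le c R S hc hε hε' hRε hSε hSε' A x ν hA hD1 hD2
  refine h.trans (le_of_eq ?_)
  rw [hE]
  ring

end Split

end Literature.MathematicalPhysics.QuantumFieldTheory.Balaban1983to89.B9Eq375BondGradDivTwoBackgroundSplit

end
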